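import Literature.Barriers.CriticalPhenomena.WeaklySAWSupersymmetricRepresentation
import Mathlib.Analysis.Complex.CauchyIntegral
import Mathlib.Analysis.Analytic.Uniqueness
import HarnessLib

/-!
# BBS 2015, Proposition 3.1 for all real `ν` (analytic continuation in `ν`)

Sequel to `WeaklySAWSupersymmetricRepresentation.lean`, completing the formalisation of
Proposition 3.1 of Bauerschmidt–Brydges–Slade, CMP 337 (2015), arXiv:1403.7422, for every real killing
rate `ν` (the source: "for `g > 0` and `ν ∈ ℝ`"; the application in the paper is at `ν = ν_c + ε` with
`ν_c < 0`). The previous file proves the identity for `ν > 0`; here both sides are shown to be entire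
functions of `ν ∈ ℂ` and the identity theorem is applied.

* Walk side (§"WalkSide"): `survivalAtReal` (`S_b(T) = E^Λ_0(e^{-gI(T)}𝟙_{X(T)=b}) ∈ [0,1]`), its
  Gaussian decay `survivalAtReal_le_exp` (`S_b(T) ≤ e^{-gT²/|Λ|}`, from `torusSurvival_le_exp`), the
  complexification **`torusTwoPointC d n g ν b = ∫₀^∞ S_b(T)e^{-νT}dT`**, the envelopes
  `integrableOn_exp_neg_sq_add` / `integrableOn_mul_exp_neg_sq_add` (`T^k e^{-κT²+RT}`), differentiation
  under the integral sign `hasDerivAt_torusTwoPointC`, **`analyticOnNhd_torusTwoPointC`** (entire), and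
  `torusTwoPoint_toReal_eq_torusTwoPointC` (agreement with the `[0,∞]`-valued `G_{N,ν}` for real `ν`).
* Form side (§"FormSideC", §"FormSideAnalytic"): `interactionFormC g ν` (`e^{-Σ(gτ²+ντ)}` for complex
  `ν`; `interactionFormC_ofReal`), **`formSideC A g ν a b = ∫ e^{-S_A}e^{-Σ(gτ²+ντ)}φ̄_aφ_b`**,
  `formSideC_eq_integral` (`= επ^{-|Λ|}∫ topC dφ` with the explicit top coefficient `topC`),
  `hasDerivAt_topC` (`∂_ν topC = topDerivC`), the uniform domination `norm_topC_le_and` of `topC` and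
  `topDerivC` on `‖ν‖ ≤ R` by the integrable `envelope A g R φ = K_R(1+‖φ‖)^{2|Λ|+4}e^{-‖φ‖²}` (the
  quartic beats every quadratic: `re_neg_sum_interactionScalarC_le`), `hasDerivAt_integral_topC`
  (differentiation under the `φ`-integral) and **`analyticOnNhd_formSideC`** (entire, for `Re φAφ̄ ≥ 0`).
* §"AllNu": **`torusTwoPointC_eq_formSideC`** (all complex `ν`, identity theorem from the positive
  reals accumulating at `1`) and the final **`torusTwoPoint_eq_superIntegral_real`**:
  for `g > 0`, every real `ν`, every `d` and period `n ≥ 1`, and every site `b`,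
  `((torusTwoPoint d n g ν b).toReal : ℂ) = superIntegral (φ_bφ̄_0 · (e^{-S_{-Δ_Λ}} · e^{-Σ(gτ_x²+ντ_x)}))`.

Everything is proved; no named facts.
-/

noncomputable section

open MeasureTheory Filter Topology Set Complex ComplexConjugate
open scoped ENNReal
open Literature.Probability.LatticeModels
open Literature.MathematicalPhysics.QuantumLattice
open Literature.MathematicalPhysics.QuantumLattice.GrassmannAlgebra (berezin)
open scoped BigOperators

namespace Literature.Barriers.CriticalPhenomena

namespace CTWSAW

/-! ### The walk side as an entire function of `ν` -/

section WalkSide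

variable {d n : ℕ} [NeZero n] {g : ℝ}

/-- `S_b(T) = E^Λ_0(e^{-gI(T)} 𝟙_{X(T)=b})` as a real number. [cite: BauerschmidtBrydgesSlade2015LogCorr, §2, eq. (2.1)] -/
def survivalAtReal (d n : ℕ) (g T : ℝ) (b : TorusSite d n) : ℝ := (torusSurvivalAt d n g T b).toReal

/-- `S_b(T) ≤ S(T)` (one term of the sum over endpoints). [folklore] -/
theorem torusSurvivalAt_le_torusSurvival (g T : ℝ) (b : TorusSite d n) :
    torusSurvivalAt d n g T b ≤ torusSurvival d n g T := by
  classical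
  rw [← sum_torusSurvivalAt n g T]
  exact Finset.single_le_sum (fun i _ => (bot_le : (0 : ℝ≥0∞) ≤ torusSurvivalAt d n g T i)) (Finset.mem_univ b)

/-- `S_b(T) ≤ 1`. [folklore] -/
theorem torusSurvivalAt_le_one (hg : 0 ≤ g) (T : ℝ) (b : TorusSite d n) : torusSurvivalAt d n g T b ≤ 1 := by
  refine (torusSurvivalAt_le_torusSurvival g T b).trans ?_
  rcases le_or_gt T 0 with hT | hT
  · rw [torusSurvival_of_nonpos n g hT]; exact bot_le
  · exact torusSurvival_le_one n hg hT

/-- `S_b(T) < ∞`. [folklore] -/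
theorem torusSurvivalAt_ne_top (hg : 0 ≤ g) (T : ℝ) (b : TorusSite d n) : torusSurvivalAt d n g T b ≠ ⊤ :=
  ne_top_of_le_ne_top ENNReal.one_ne_top (torusSurvivalAt_le_one hg T b)

omit [NeZero n] in
/-- `0 ≤ S_b(T)`. [folklore] -/
theorem survivalAtReal_nonneg (g T : ℝ) (b : TorusSite d n) : 0 ≤ survivalAtReal d n g T b :=
  ENNReal.toReal_nonneg

/-- `S_b(T) ≤ 1`. [folklore] -/
theorem survivalAtReal_le_one (hg : 0 ≤ g) (T : ℝ) (b : TorusSite d n) : survivalAtReal d n g T b ≤ 1 := by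
  unfold survivalAtReal
  have h := ENNReal.toReal_mono ENNReal.one_ne_top (torusSurvivalAt_le_one hg T b)
  simpa using h

/-- **The Gaussian decay `S_b(T) ≤ e^{-gT²/|Λ|}`** (`T > 0`; Cauchy–Schwarz on the local times).
[cite: BauerschmidtBrydgesSlade2015LogCorr, Lemma 2.1 (proof, c_{N,T} ≤ e^{-gT²/|Λ_N|}·…)] -/
theorem survivalAtReal_le_exp (hg : 0 ≤ g) {T : ℝ} (hT : 0 < T) (b : TorusSite d n) :
    survivalAtReal d n g T b ≤ Real.exp (-(g * T ^ 2 / (n : ℝ) ^ d)) := by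
  unfold survivalAtReal
  have h := (torusSurvivalAt_le_torusSurvival g T b).trans (torusSurvival_le_exp n hg hT)
  have h' := ENNReal.toReal_mono ENNReal.ofReal_ne_top h
  rwa [ENNReal.toReal_ofReal (Real.exp_pos _).le] at h'

omit [NeZero n] in
/-- `T ↦ S_b(T)` is measurable. [folklore] -/
theorem measurable_survivalAtReal (g : ℝ) (b : TorusSite d n) :
    Measurable fun T => survivalAtReal d n g T b :=
  (measurable_torusWeightedExpectation d n g _).ennreal_toReal

/-- **`G_{N,ν}(0,b)` for complex `ν`**: `∫₀^∞ S_b(T) e^{-νT} dT`. [cite: BauerschmidtBrydgesSlade2015LogCorr, §2, eq. (2.3)] -/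
def torusTwoPointC (d n : ℕ) (g : ℝ) (ν : ℂ) (b : TorusSite d n) : ℂ :=
  ∫ T in Ioi (0 : ℝ), (survivalAtReal d n g T b : ℂ) * cexp (-ν * T)

/-- Completing the square: `e^{-κT² + cT} ≤ e^{c²/(2κ)} e^{-(κ/2)T²}` (`κ > 0`). [folklore] -/
theorem exp_neg_sq_add_le {κ : ℝ} (hκ : 0 < κ) (c T : ℝ) :
    Real.exp (-κ * T ^ 2 + c * T) ≤ Real.exp (c ^ 2 / (2 * κ)) * Real.exp (-(κ / 2) * T ^ 2) := by
  rw [← Real.exp_add]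
  refine Real.exp_le_exp.2 ?_
  have h : 0 ≤ κ / 2 * (T - c / κ) ^ 2 := by positivity
  have h' : κ / 2 * (T - c / κ) ^ 2 = κ / 2 * T ^ 2 - c * T + c ^ 2 / (2 * κ) := by
    field_simp; ring
  linarith [h, h']

/-- `e^{-κT² + RT}` is integrable on `(0,∞)` (`κ > 0`). [folklore] -/
theorem integrableOn_exp_neg_sq_add {κ : ℝ} (hκ : 0 < κ) (R : ℝ) :
    IntegrableOn (fun T : ℝ => Real.exp (-κ * T ^ 2 + R * T)) (Ioi 0) := by
  have h := ((integrable_exp_neg_mul_sq (b := κ / 2) (by positivity)).const_mul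
    (Real.exp (R ^ 2 / (2 * κ)))).integrableOn (s := Ioi 0)
  refine h.mono' (by fun_prop) ((ae_restrict_mem measurableSet_Ioi).mono fun T _ => ?_)
  rw [Real.norm_eq_abs, abs_of_pos (Real.exp_pos _)]
  exact exp_neg_sq_add_le hκ R T

/-- `T e^{-κT² + RT}` is integrable on `(0,∞)` (`κ > 0`; `T ≤ e^T`). [folklore] -/
theorem integrableOn_mul_exp_neg_sq_add {κ : ℝ} (hκ : 0 < κ) (R : ℝ) :
    IntegrableOn (fun T : ℝ => T * Real.exp (-κ * T ^ 2 + R * T)) (Ioi 0) := by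
  refine (integrableOn_exp_neg_sq_add hκ (R + 1)).mono' (by fun_prop)
    ((ae_restrict_mem measurableSet_Ioi).mono fun T hT => ?_)
  have hT' : 0 < T := hT
  rw [Real.norm_eq_abs, abs_of_nonneg (by positivity)]
  have h1 : T ≤ Real.exp T := by linarith [Real.add_one_le_exp T]
  calc T * Real.exp (-κ * T ^ 2 + R * T) ≤ Real.exp T * Real.exp (-κ * T ^ 2 + R * T) :=
        mul_le_mul_of_nonneg_right h1 (Real.exp_pos _).le
    _ = Real.exp (-κ * T ^ 2 + (R + 1) * T) := by rw [← Real.exp_add]; ring_nf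

/-- The Gaussian decay rate `κ_N = g/|Λ_N|`. [folklore] -/
def decayRate (d n : ℕ) (g : ℝ) : ℝ := g / (n : ℝ) ^ d

omit [NeZero n] in
/-- `κ_N > 0` for `g > 0`, `n ≥ 1`. [folklore] -/
theorem decayRate_pos (hg : 0 < g) (hn : 0 < n) : 0 < decayRate d n g := by
  unfold decayRate; positivity

/-- `S_b(T) ≤ e^{-κ_N T²}` on `(0,∞)`, in the form used for domination. [folklore] -/
theorem survivalAtReal_le_exp' (hg : 0 ≤ g) {T : ℝ} (hT : 0 < T) (b : TorusSite d n) :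
    survivalAtReal d n g T b ≤ Real.exp (-decayRate d n g * T ^ 2 + 0 * T) := by
  refine (survivalAtReal_le_exp hg hT b).trans (le_of_eq ?_)
  congr 1; unfold decayRate; ring

omit [NeZero n] in
/-- The integrand of `G_{N,ν}(0,b)` and its `ν`-derivative are a.e.-strongly measurable. [folklore] -/
theorem aestronglyMeasurable_walkIntegrand (g : ℝ) (b : TorusSite d n) (ν : ℂ) (k : ℕ) :
    AEStronglyMeasurable (fun T : ℝ => (survivalAtReal d n g T b : ℂ) * ((-(T : ℂ)) ^ k * cexp (-ν * T)))
      (volume.restrict (Ioi 0)) := by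
  refine ((Complex.measurable_ofReal.comp (measurable_survivalAtReal g b)).mul ?_).aestronglyMeasurable
  exact (by fun_prop : Continuous fun T : ℝ => (-(T : ℂ)) ^ k * cexp (-ν * T)).measurable

/-- Domination: `‖S_b(T) (-T)^k e^{-νT}‖ ≤ T^k e^{-κ_N T² + RT}` for `‖ν‖ ≤ R`, `T > 0`. [folklore] -/
theorem norm_walkIntegrand_le (hg : 0 ≤ g) (b : TorusSite d n) {ν : ℂ} {R : ℝ} (hν : ‖ν‖ ≤ R) {T : ℝ}
    (hT : 0 < T) (k : ℕ) :
    ‖(survivalAtReal d n g T b : ℂ) * ((-(T : ℂ)) ^ k * cexp (-ν * T))‖ ≤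
      T ^ k * Real.exp (-decayRate d n g * T ^ 2 + R * T) := by
  rw [norm_mul, norm_mul, norm_pow, norm_neg, Complex.norm_real, Complex.norm_real, Real.norm_eq_abs,
    Real.norm_eq_abs, abs_of_nonneg (survivalAtReal_nonneg g T b), abs_of_pos hT, Complex.norm_exp]
  have hre : (-ν * (T : ℂ)).re ≤ R * T := by
    rw [neg_mul, Complex.neg_re, Complex.mul_re, Complex.ofReal_re, Complex.ofReal_im, mul_zero, sub_zero]
    have : -(ν.re * T) ≤ ‖ν‖ * T := by
      have h1 : -ν.re ≤ ‖ν‖ := (neg_le_abs _).trans (Complex.abs_re_le_norm ν)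
      nlinarith
    nlinarith
  calc survivalAtReal d n g T b * (T ^ k * Real.exp (-ν * (T : ℂ)).re)
      ≤ Real.exp (-decayRate d n g * T ^ 2 + 0 * T) * (T ^ k * Real.exp (R * T)) := by
        refine mul_le_mul (survivalAtReal_le_exp' hg hT b) ?_ (by positivity) (Real.exp_pos _).le
        exact mul_le_mul_of_nonneg_left (Real.exp_le_exp.2 hre) (by positivity)
    _ = T ^ k * Real.exp (-decayRate d n g * T ^ 2 + R * T) := by
        rw [mul_comm, mul_assoc, ← Real.exp_add]; ring_nf

/-- The integrand of `G_{N,ν}(0,b)` (and `T` times it) is integrable on `(0,∞)` for every complex `ν`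
(`g > 0`). [folklore] -/
theorem integrableOn_walkIntegrand (hg : 0 < g) (b : TorusSite d n) (ν : ℂ) (k : ℕ) (hk : k ≤ 1) :
    IntegrableOn (fun T : ℝ => (survivalAtReal d n g T b : ℂ) * ((-(T : ℂ)) ^ k * cexp (-ν * T))) (Ioi 0) := by
  have hκ := decayRate_pos (d := d) hg (Nat.pos_of_ne_zero (NeZero.ne n))
  have hbound : IntegrableOn (fun T : ℝ => T ^ k * Real.exp (-decayRate d n g * T ^ 2 + ‖ν‖ * T)) (Ioi 0) := by
    interval_cases k
    · simpa using integrableOn_exp_neg_sq_add hκ ‖ν‖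
    · simpa using integrableOn_mul_exp_neg_sq_add hκ ‖ν‖
  exact hbound.mono' (aestronglyMeasurable_walkIntegrand g b ν k)
    ((ae_restrict_mem measurableSet_Ioi).mono fun T hT => norm_walkIntegrand_le hg.le b le_rfl hT k)

/-- **`G_{N,ν}(0,b)` is an entire function of `ν`** (`g > 0`): differentiation under the integral sign,
dominated by `T e^{-κ_NT² + (‖ν₀‖+1)T}`. [cite: BauerschmidtBrydgesSlade2015LogCorr, Lemma 2.1 (proof: "χ_N is analytic on all of ℂ")] -/
theorem hasDerivAt_torusTwoPointC (hg : 0 < g) (b : TorusSite d n) (ν₀ : ℂ) :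
    HasDerivAt (fun ν => torusTwoPointC d n g ν b)
      (∫ T in Ioi (0 : ℝ), (survivalAtReal d n g T b : ℂ) * ((-(T : ℂ)) ^ 1 * cexp (-ν₀ * T))) ν₀ := by
  have hκ := decayRate_pos (d := d) hg (Nat.pos_of_ne_zero (NeZero.ne n))
  set F : ℂ → ℝ → ℂ := fun ν T => (survivalAtReal d n g T b : ℂ) * ((-(T : ℂ)) ^ 0 * cexp (-ν * T)) with hF
  set F' : ℂ → ℝ → ℂ := fun ν T => (survivalAtReal d n g T b : ℂ) * ((-(T : ℂ)) ^ 1 * cexp (-ν * T)) with hF'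
  have hFeq : (fun ν => torusTwoPointC d n g ν b) = fun ν => ∫ T in Ioi (0 : ℝ), F ν T := by
    funext ν; simp only [torusTwoPointC, hF, pow_zero, one_mul]
  rw [hFeq]
  set bound : ℝ → ℝ := fun T => T ^ 1 * Real.exp (-decayRate d n g * T ^ 2 + (‖ν₀‖ + 1) * T) with hb
  have hbound_int : IntegrableOn bound (Ioi 0) := by
    simpa [hb] using integrableOn_mul_exp_neg_sq_add hκ (‖ν₀‖ + 1)
  refine (hasDerivAt_integral_of_dominated_loc_of_deriv_le (μ := volume.restrict (Ioi 0)) (x₀ := ν₀)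
    (s := Metric.ball ν₀ 1) (F := F) (F' := F') (bound := bound) (Metric.ball_mem_nhds ν₀ one_pos)
    (Eventually.of_forall fun ν => aestronglyMeasurable_walkIntegrand g b ν 0)
    (integrableOn_walkIntegrand hg b ν₀ 0 zero_le_one) (aestronglyMeasurable_walkIntegrand g b ν₀ 1)
    ?_ hbound_int ?_).2
  · refine (ae_restrict_mem measurableSet_Ioi).mono fun T hT ν hν => ?_
    have hν' : ‖ν‖ ≤ ‖ν₀‖ + 1 := by
      have := Metric.mem_ball.1 hν
      calc ‖ν‖ = ‖ν₀ + (ν - ν₀)‖ := by ring_nf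
        _ ≤ ‖ν₀‖ + ‖ν - ν₀‖ := norm_add_le _ _
        _ ≤ ‖ν₀‖ + 1 := by rw [← dist_eq_norm]; linarith
    exact norm_walkIntegrand_le hg.le b hν' hT 1
  · refine Eventually.of_forall fun T ν _ => ?_
    simp only [hF, hF', pow_zero, one_mul, pow_one]
    have h0 : HasDerivAt (fun ν : ℂ => -ν * T) (-(T : ℂ)) ν := by
      simpa using ((hasDerivAt_id ν).neg.mul_const (T : ℂ))
    have h1 := h0.cexp.const_mul (survivalAtReal d n g T b : ℂ)
    refine h1.congr_deriv ?_; ring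

/-- `G_{N,·}(0,b)` is entire. [cite: BauerschmidtBrydgesSlade2015LogCorr, Lemma 2.1 (proof)] -/
theorem differentiable_torusTwoPointC (hg : 0 < g) (b : TorusSite d n) :
    Differentiable ℂ fun ν => torusTwoPointC d n g ν b := fun ν =>
  (hasDerivAt_torusTwoPointC hg b ν).differentiableAt

/-- `G_{N,·}(0,b)` is analytic on `ℂ`. [folklore] -/
theorem analyticOnNhd_torusTwoPointC (hg : 0 < g) (b : TorusSite d n) :
    AnalyticOnNhd ℂ (fun ν => torusTwoPointC d n g ν b) univ :=
  (differentiable_torusTwoPointC hg b).differentiableOn.analyticOnNhd isOpen_univ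

/-- **The complexification extends `G_{N,ν}(0,b)`**: for real `ν`,
`(torusTwoPoint d n g ν b).toReal = G_{N,ν}(0,b)` as complex numbers (`g > 0`). [folklore] -/
theorem torusTwoPoint_toReal_eq_torusTwoPointC (hg : 0 < g) (ν : ℝ) (b : TorusSite d n) :
    (((torusTwoPoint d n g ν b).toReal : ℝ) : ℂ) = torusTwoPointC d n g ν b := by
  have hκ := decayRate_pos (d := d) hg (Nat.pos_of_ne_zero (NeZero.ne n))
  -- the real integrand and its integrability
  set f : ℝ → ℝ := fun T => survivalAtReal d n g T b * Real.exp (-ν * T) with hf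
  have hf_nn : 0 ≤ᵐ[volume.restrict (Ioi 0)] f :=
    Eventually.of_forall fun T => mul_nonneg (survivalAtReal_nonneg g T b) (Real.exp_pos _).le
  have hf_int : IntegrableOn f (Ioi 0) := by
    have h := integrableOn_walkIntegrand hg b (ν : ℂ) 0 zero_le_one
    have h' := h.norm
    refine h'.congr ((ae_restrict_mem measurableSet_Ioi).mono fun T hT => ?_)
    simp only [hf, pow_zero, one_mul, norm_mul, Complex.norm_real, Real.norm_eq_abs,
      abs_of_nonneg (survivalAtReal_nonneg g T b), Complex.norm_exp]
    congr 1
    rw [neg_mul, Complex.neg_re, Complex.mul_re, Complex.ofReal_re, Complex.ofReal_im, Complex.ofReal_re,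
      Complex.ofReal_im, mul_zero, sub_zero, neg_mul]
  -- `torusTwoPoint = ∫⁻ ofReal f`
  have h1 : torusTwoPoint d n g ν b = ∫⁻ T in Ioi 0, ENNReal.ofReal (f T) := by
    unfold torusTwoPoint
    refine setLIntegral_congr_fun measurableSet_Ioi fun T _ => ?_
    rw [hf]; simp only
    rw [ENNReal.ofReal_mul (survivalAtReal_nonneg g T b), survivalAtReal,
      ENNReal.ofReal_toReal (torusSurvivalAt_ne_top hg.le T b)]
  rw [h1, ← ofReal_integral_eq_lintegral_ofReal hf_int hf_nn, ENNReal.toReal_ofReal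
    (integral_nonneg_of_ae hf_nn), ← integral_complex_ofReal]
  unfold torusTwoPointC
  refine integral_congr_ae (Eventually.of_forall fun T => ?_)
  simp only [hf]
  push_cast
  ring_nf

end WalkSide


/-! ### The form side for complex `ν` -/

section FormSideC

variable {Λ : Type*} [Fintype Λ] [LinearOrder Λ]

/-- `a_x(ν) = g|φ_x|⁴ + ν|φ_x|²` for complex `ν`. [folklore] -/
def interactionScalarC (g : ℝ) (ν : ℂ) (x : Λ) : FieldFun Λ :=
  fun φ => (g : ℂ) * (((‖φ x‖ ^ 4 : ℝ)) : ℂ) + ν * (((‖φ x‖ ^ 2 : ℝ)) : ℂ)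

/-- `b_x(ν) = 2g|φ_x|² + ν` for complex `ν`. [folklore] -/
def interactionCoeffC (g : ℝ) (ν : ℂ) (x : Λ) : FieldFun Λ :=
  fun φ => 2 * (g : ℂ) * (((‖φ x‖ ^ 2 : ℝ)) : ℂ) + ν

/-- **`e^{-Σ_x(gτ_x² + ντ_x)}` for complex `ν`** (same definition as `interactionForm`).
[cite: BauerschmidtBrydgesSlade2015LogCorr, §3.2–3.3 and Proposition 3.1 ("ν ∈ ℂ" in (3.12) via analyticity)] -/
def interactionFormC (g : ℝ) (ν : ℂ) : SForm Λ :=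
  ofFun (fun φ => cexp (-∑ x, interactionScalarC g ν x φ)) *
    grassmannExp (quadratic (FieldFun Λ) (Matrix.diagonal (interactionCoeffC g ν)))

omit [Fintype Λ] [LinearOrder Λ] in
/-- Real `ν`: `a_x` agrees. [folklore] -/
theorem interactionScalarC_ofReal (g ν : ℝ) (x : Λ) :
    interactionScalarC g (ν : ℂ) x = interactionScalar g ν x := by
  funext φ; simp only [interactionScalarC, interactionScalar]; push_cast; ring

omit [Fintype Λ] [LinearOrder Λ] in
/-- Real `ν`: `b_x` agrees. [folklore] -/
theorem interactionCoeffC_ofReal (g ν : ℝ) (x : Λ) :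
    interactionCoeffC g (ν : ℂ) x = interactionCoeff g ν x := by
  funext φ; simp only [interactionCoeffC, interactionCoeff]; push_cast; ring

/-- Real `ν`: the complex-`ν` interaction form IS `interactionForm`. [folklore] -/
theorem interactionFormC_ofReal (g ν : ℝ) : (interactionFormC g (ν : ℂ) : SForm Λ) = interactionForm g ν := by
  unfold interactionFormC interactionForm
  have h1 : (interactionCoeffC g (ν : ℂ) : Λ → FieldFun Λ) = interactionCoeff g ν :=
    funext fun x => interactionCoeffC_ofReal g ν x
  have h2 : (fun φ : Λ → ℂ => cexp (-∑ x, interactionScalarC g (ν : ℂ) x φ)) =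
      fun φ => cexp (-∑ x, interactionScalar g ν x φ) := by
    funext φ; simp_rw [interactionScalarC_ofReal]
  rw [h1, h2]

/-- `e^{-S_A}·e^{-Σ(gτ²+ντ)}` factorised, complex `ν`. [folklore] -/
theorem superGauss_mul_interactionFormC (A : Matrix Λ Λ ℂ) (g : ℝ) (ν : ℂ) :
    superGauss A * interactionFormC g ν =
      ofFun (fun φ => Boson.gaussWeight A φ * cexp (-∑ x, interactionScalarC g ν x φ)) *
        grassmannExp (quadratic (FieldFun Λ)
          (constMat A.transpose + Matrix.diagonal (interactionCoeffC g ν))) := by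
  have hfun : (fun φ => Boson.gaussWeight A φ * cexp (-∑ x, interactionScalarC g ν x φ)) =
      (fun φ => Boson.gaussWeight A φ) * fun φ => cexp (-∑ x, interactionScalarC g ν x φ) := rfl
  rw [superGauss_eq, interactionFormC, grassmannExp_quadratic_add, hfun, ← ofFun_mul_ofFun]
  set E₁ := grassmannExp (quadratic (FieldFun Λ) (constMat A.transpose))
  rw [mul_assoc, ← mul_assoc E₁, (ofFun_comm _ E₁).symm, mul_assoc, ← mul_assoc]

/-- Top coefficient of `h e^{-S_A} e^{-Σ(gτ²+ντ)}`, complex `ν`. [folklore] -/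
theorem berezin_ofFun_mul_superGauss_mul_interactionFormC_apply (h : FieldFun Λ) (A : Matrix Λ Λ ℂ)
    (g : ℝ) (ν : ℂ) (φ : Λ → ℂ) :
    berezin (FieldFun Λ) (Λ ⊕ₗ Λ) (ofFun h * (superGauss A * interactionFormC g ν)) φ =
      h φ * (Boson.gaussWeight A φ * cexp (-∑ x, interactionScalarC g ν x φ)) *
        ∑ S : Finset Λ, (∏ x ∈ S, interactionCoeffC g ν x φ) *
          (orientSign Λ * (rowUnitMatrix A.transpose S).det) := by
  rw [superGauss_mul_interactionFormC, ← mul_assoc, ofFun_mul_ofFun,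
    berezin_ofFun_mul_grassmannExp_quadratic_add_diagonal]
  simp only [pairMoment_constMat, Pi.mul_apply, Finset.sum_apply, Finset.prod_apply, constFun]

/-- The top coefficient of `φ_bφ̄_a e^{-S_A}e^{-Σ(gτ²+ντ)}` as an explicit function of `(ν, φ)`. [folklore] -/
def topC (A : Matrix Λ Λ ℂ) (g : ℝ) (a b : Λ) (ν : ℂ) (φ : Λ → ℂ) : ℂ :=
  φ b * conj (φ a) * (Boson.gaussWeight A φ * cexp (-∑ x, interactionScalarC g ν x φ)) *
    ∑ S : Finset Λ, (∏ x ∈ S, interactionCoeffC g ν x φ) * (orientSign Λ * (rowUnitMatrix A.transpose S).det)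

/-- **The form side `∫ e^{-S_A}e^{-Σ(gτ_x²+ντ_x)} φ̄_aφ_b` as a function of complex `ν`.**
[cite: BauerschmidtBrydgesSlade2015LogCorr, Proposition 3.1, eq. (3.12)] -/
def formSideC (A : Matrix Λ Λ ℂ) (g : ℝ) (ν : ℂ) (a b : Λ) : ℂ :=
  superIntegral (ofFun (fun φ => φ b * conj (φ a)) * (superGauss A * interactionFormC g ν))

/-- `formSideC = ε π^{-|Λ|} ∫ topC dφ`. [folklore] -/
theorem formSideC_eq_integral (A : Matrix Λ Λ ℂ) (g : ℝ) (ν : ℂ) (a b : Λ) :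
    formSideC A g ν a b = orientSign Λ * ((Real.pi : ℂ)⁻¹) ^ Fintype.card Λ * ∫ φ, topC A g a b ν φ := by
  rw [formSideC, superIntegral]
  congr 1
  refine integral_congr_ae (Eventually.of_forall fun φ => ?_)
  exact berezin_ofFun_mul_superGauss_mul_interactionFormC_apply _ A g ν φ

/-- Real `ν`: `formSideC` is the super-integral of `WeaklySAWTauIsomorphism.lean`. [folklore] -/
theorem formSideC_ofReal (A : Matrix Λ Λ ℂ) (g ν : ℝ) (a b : Λ) :
    formSideC A g (ν : ℂ) a b =
      superIntegral (ofFun (fun φ => φ b * conj (φ a)) * (superGauss A * interactionForm g ν)) := by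
  rw [formSideC, interactionFormC_ofReal]

end FormSideC


/-! ### Analyticity of the form side in `ν` -/

section FormSideAnalytic

variable {Λ : Type*} [Fintype Λ] [LinearOrder Λ]

/-- `Σ_x |φ_x|²` as a complex number. [folklore] -/
def sumSqC (φ : Λ → ℂ) : ℂ := ∑ x, (((‖φ x‖ ^ 2 : ℝ)) : ℂ)

/-- `P(ν, φ) = Σ_S (Π_{x∈S} b_x(ν)) μ_S`. [folklore] -/
def coeffPoly (A : Matrix Λ Λ ℂ) (g : ℝ) (ν : ℂ) (φ : Λ → ℂ) : ℂ :=
  ∑ S : Finset Λ, (∏ x ∈ S, interactionCoeffC g ν x φ) * (orientSign Λ * (rowUnitMatrix A.transpose S).det)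

/-- `∂_ν P(ν, φ) = Σ_S (Σ_{y∈S} Π_{x∈S∖y} b_x(ν)) μ_S`. [folklore] -/
def coeffPolyDeriv (A : Matrix Λ Λ ℂ) (g : ℝ) (ν : ℂ) (φ : Λ → ℂ) : ℂ :=
  ∑ S : Finset Λ, (∑ y ∈ S, ∏ x ∈ S.erase y, interactionCoeffC g ν x φ) *
    (orientSign Λ * (rowUnitMatrix A.transpose S).det)

/-- The `ν`-derivative of `topC`. [folklore] -/
def topDerivC (A : Matrix Λ Λ ℂ) (g : ℝ) (a b : Λ) (ν : ℂ) (φ : Λ → ℂ) : ℂ :=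
  φ b * conj (φ a) * (Boson.gaussWeight A φ * cexp (-∑ x, interactionScalarC g ν x φ)) *
    (-sumSqC φ * coeffPoly A g ν φ + coeffPolyDeriv A g ν φ)

omit [LinearOrder Λ] in
/-- `-Σ_x a_x(ν) = -gΣ|φ_x|⁴ - ν Σ|φ_x|²` is affine in `ν`. [folklore] -/
theorem neg_sum_interactionScalarC_eq (g : ℝ) (ν : ℂ) (φ : Λ → ℂ) :
    -∑ x, interactionScalarC g ν x φ = -((g : ℂ) * ∑ x, (((‖φ x‖ ^ 4 : ℝ)) : ℂ)) - ν * sumSqC φ := by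
  simp only [interactionScalarC, sumSqC, Finset.sum_add_distrib, Finset.mul_sum]
  ring

/-- **`topC` is entire in `ν` with derivative `topDerivC`.** [folklore] -/
theorem hasDerivAt_topC (A : Matrix Λ Λ ℂ) (g : ℝ) (a b : Λ) (φ : Λ → ℂ) (ν : ℂ) :
    HasDerivAt (fun ν => topC A g a b ν φ) (topDerivC A g a b ν φ) ν := by
  -- the exponential factor
  set C₀ : ℂ := -((g : ℂ) * ∑ x, (((‖φ x‖ ^ 4 : ℝ)) : ℂ)) with hC₀
  have hfun : (fun ν : ℂ => cexp (-∑ x, interactionScalarC g ν x φ)) =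
      fun ν => cexp (C₀ - ν * sumSqC φ) := by
    funext ν; rw [neg_sum_interactionScalarC_eq]
  have hE : HasDerivAt (fun ν : ℂ => cexp (-∑ x, interactionScalarC g ν x φ))
      (cexp (-∑ x, interactionScalarC g ν x φ) * -sumSqC φ) ν := by
    rw [hfun, neg_sum_interactionScalarC_eq]
    have h0 : HasDerivAt (fun ν : ℂ => C₀ - ν * sumSqC φ) (0 - 1 * sumSqC φ) ν :=
      (hasDerivAt_const ν C₀).sub ((hasDerivAt_id ν).mul_const (sumSqC φ))
    refine h0.cexp.congr_deriv ?_
    ring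
  -- the polynomial factor
  have hb : ∀ x, HasDerivAt (fun ν : ℂ => interactionCoeffC g ν x φ) 1 ν := fun x =>
    (hasDerivAt_id ν).const_add (2 * (g : ℂ) * (((‖φ x‖ ^ 2 : ℝ)) : ℂ))
  have hP : HasDerivAt (fun ν : ℂ => coeffPoly A g ν φ) (coeffPolyDeriv A g ν φ) ν := by
    unfold coeffPoly coeffPolyDeriv
    refine HasDerivAt.fun_sum fun S _ => ?_
    have hprod := HasDerivAt.finsetProd (u := S) (f := fun x (ν : ℂ) => interactionCoeffC g ν x φ)
      (f' := fun _ => (1 : ℂ)) (x := ν) fun x _ => hb x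
    simp only [smul_eq_mul, mul_one] at hprod
    have hprod' : HasDerivAt (fun ν : ℂ => ∏ x ∈ S, interactionCoeffC g ν x φ)
        (∑ y ∈ S, ∏ x ∈ S.erase y, interactionCoeffC g ν x φ) ν := by
      refine hprod.congr_of_eventuallyEq (Eventually.of_forall fun ν' => ?_)
      simp [Finset.prod_apply]
    exact hprod'.mul_const _
  -- assemble
  have h := ((hE.const_mul (Boson.gaussWeight A φ)).const_mul (φ b * conj (φ a))).mul hP
  refine h.congr_deriv ?_
  simp only [topDerivC]
  ring

variable {A : Matrix Λ Λ ℂ} {g R : ℝ} {ν : ℂ}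

omit [Fintype Λ] [LinearOrder Λ] in
/-- `|b_x(ν)| ≤ 2g|φ_x|² + R` for `‖ν‖ ≤ R`, `g ≥ 0`. [folklore] -/
theorem norm_interactionCoeffC_le (hg : 0 ≤ g) (hν : ‖ν‖ ≤ R) (x : Λ) (φ : Λ → ℂ) :
    ‖interactionCoeffC g ν x φ‖ ≤ 2 * g * ‖φ x‖ ^ 2 + R := by
  unfold interactionCoeffC
  refine (norm_add_le _ _).trans (add_le_add (le_of_eq ?_) hν)
  rw [norm_mul, norm_mul, Complex.norm_real, Complex.norm_real, Real.norm_eq_abs, Real.norm_eq_abs,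
    abs_of_nonneg hg, abs_of_nonneg (sq_nonneg _)]
  simp

/-- The site product envelope `Π_x(1 + 2g|φ_x|² + R)`. [folklore] -/
def siteEnvelope (g R : ℝ) (φ : Λ → ℂ) : ℝ := ∏ x, (1 + (2 * g * ‖φ x‖ ^ 2 + R))

/-- `Π_{x∈S}(2g|φ_x|²+R) ≤ siteEnvelope`. [folklore] -/
theorem prod_coeff_bound_le (hg : 0 ≤ g) (hR : 0 ≤ R) (S : Finset Λ) (φ : Λ → ℂ) :
    ∏ x ∈ S, (2 * g * ‖φ x‖ ^ 2 + R) ≤ siteEnvelope g R φ :=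
  prod_le_prod_one_add (f := fun x => 2 * g * ‖φ x‖ ^ 2 + R) (fun x => by positivity) S

/-- `|P(ν,φ)| ≤ C_μ · siteEnvelope`. [folklore] -/
theorem norm_coeffPoly_le (hg : 0 ≤ g) (hR : 0 ≤ R) (hν : ‖ν‖ ≤ R) (φ : Λ → ℂ) :
    ‖coeffPoly A g ν φ‖ ≤ (∑ S : Finset Λ, ‖orientSign Λ * (rowUnitMatrix A.transpose S).det‖) *
      siteEnvelope g R φ := by
  unfold coeffPoly
  refine (norm_sum_le _ _).trans ?_
  rw [Finset.sum_mul]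
  refine Finset.sum_le_sum fun S _ => ?_
  rw [norm_mul, mul_comm]
  refine mul_le_mul_of_nonneg_left ?_ (norm_nonneg _)
  calc ‖∏ x ∈ S, interactionCoeffC g ν x φ‖ = ∏ x ∈ S, ‖interactionCoeffC g ν x φ‖ := norm_prod _ _
    _ ≤ ∏ x ∈ S, (2 * g * ‖φ x‖ ^ 2 + R) :=
        Finset.prod_le_prod (fun x _ => norm_nonneg _) fun x _ => norm_interactionCoeffC_le hg hν x φ
    _ ≤ siteEnvelope g R φ := prod_coeff_bound_le hg hR S φ

/-- `|∂_νP(ν,φ)| ≤ C_μ · |Λ| · siteEnvelope`. [folklore] -/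
theorem norm_coeffPolyDeriv_le (hg : 0 ≤ g) (hR : 0 ≤ R) (hν : ‖ν‖ ≤ R) (φ : Λ → ℂ) :
    ‖coeffPolyDeriv A g ν φ‖ ≤ (∑ S : Finset Λ, ‖orientSign Λ * (rowUnitMatrix A.transpose S).det‖) *
      (Fintype.card Λ * siteEnvelope g R φ) := by
  unfold coeffPolyDeriv
  refine (norm_sum_le _ _).trans ?_
  rw [Finset.sum_mul]
  refine Finset.sum_le_sum fun S _ => ?_
  rw [norm_mul, mul_comm]
  refine mul_le_mul_of_nonneg_left ?_ (norm_nonneg _)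
  refine (norm_sum_le _ _).trans ?_
  have hterm : ∀ y ∈ S, ‖∏ x ∈ S.erase y, interactionCoeffC g ν x φ‖ ≤ siteEnvelope g R φ := by
    intro y _
    calc ‖∏ x ∈ S.erase y, interactionCoeffC g ν x φ‖ = ∏ x ∈ S.erase y, ‖interactionCoeffC g ν x φ‖ :=
          norm_prod _ _
      _ ≤ ∏ x ∈ S.erase y, (2 * g * ‖φ x‖ ^ 2 + R) :=
          Finset.prod_le_prod (fun x _ => norm_nonneg _) fun x _ => norm_interactionCoeffC_le hg hν x φ
      _ ≤ siteEnvelope g R φ := prod_coeff_bound_le hg hR _ φ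
  calc ∑ y ∈ S, ‖∏ x ∈ S.erase y, interactionCoeffC g ν x φ‖ ≤ ∑ _y ∈ S, siteEnvelope g R φ :=
        Finset.sum_le_sum hterm
    _ = S.card * siteEnvelope g R φ := by rw [Finset.sum_const, nsmul_eq_mul]
    _ ≤ Fintype.card Λ * siteEnvelope g R φ := by
        have hpos : 0 ≤ siteEnvelope g R φ := Finset.prod_nonneg fun x _ => by positivity
        exact mul_le_mul_of_nonneg_right (by exact_mod_cast Finset.card_le_univ S) hpos

omit [LinearOrder Λ] in
/-- `siteEnvelope ≤ ((1+2g+R)(1+‖φ‖)²)^{|Λ|}`. [folklore] -/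
theorem siteEnvelope_le (hg : 0 ≤ g) (hR : 0 ≤ R) (φ : Λ → ℂ) :
    siteEnvelope g R φ ≤ ((1 + 2 * g + R) * (1 + ‖φ‖) ^ 2) ^ Fintype.card Λ := by
  unfold siteEnvelope
  rw [← Finset.card_univ, ← Finset.prod_const]
  refine Finset.prod_le_prod (fun x _ => by positivity) fun x _ => ?_
  have hx : ‖φ x‖ ≤ ‖φ‖ := norm_le_pi_norm φ x
  have h1 : (1 : ℝ) ≤ (1 + ‖φ‖) ^ 2 := by nlinarith [norm_nonneg φ]
  have h2 : ‖φ x‖ ^ 2 ≤ (1 + ‖φ‖) ^ 2 := by nlinarith [norm_nonneg (φ x), norm_nonneg φ]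
  nlinarith [mul_nonneg hg (sub_nonneg.2 h2), mul_nonneg hR (sub_nonneg.2 h1)]

omit [LinearOrder Λ] in
/-- `Σ_x|φ_x|² ≤ |Λ|‖φ‖²`. [folklore] -/
theorem sum_sq_le_card_mul (φ : Λ → ℂ) : ∑ x, ‖φ x‖ ^ 2 ≤ Fintype.card Λ * ‖φ‖ ^ 2 := by
  calc ∑ x, ‖φ x‖ ^ 2 ≤ ∑ _x : Λ, ‖φ‖ ^ 2 :=
        Finset.sum_le_sum fun x _ => pow_le_pow_left₀ (norm_nonneg _) (norm_le_pi_norm φ x) 2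
    _ = Fintype.card Λ * ‖φ‖ ^ 2 := by rw [Finset.sum_const, Finset.card_univ, nsmul_eq_mul]

omit [LinearOrder Λ] in
/-- **The quartic beats every quadratic**: `Re(-Σ_x a_x(ν)) ≤ -‖φ‖² + |Λ|(R+1)²/(4g)` for `‖ν‖ ≤ R`,
`g > 0`, `Λ ≠ ∅`. [folklore] -/
theorem re_neg_sum_interactionScalarC_le (hg : 0 < g) (hν : ‖ν‖ ≤ R) [Nonempty Λ] (φ : Λ → ℂ) :
    (-∑ x, interactionScalarC g ν x φ).re ≤ -‖φ‖ ^ 2 + Fintype.card Λ * (R + 1) ^ 2 / (4 * g) := by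
  set t : ℝ := ∑ x, ‖φ x‖ ^ 2 with ht
  set q : ℝ := ∑ x, ‖φ x‖ ^ 4 with hq
  set M : ℝ := (Fintype.card Λ : ℝ) with hM
  have hMpos : 0 < M := by rw [hM]; exact_mod_cast Fintype.card_pos
  have hre : (-∑ x, interactionScalarC g ν x φ).re = -(g * q) - ν.re * t := by
    rw [neg_sum_interactionScalarC_eq, Complex.sub_re, Complex.neg_re, Complex.mul_re, Complex.re_sum,
      Complex.im_sum, sumSqC, Complex.mul_re, Complex.re_sum, Complex.im_sum]
    simp only [Complex.ofReal_re, Complex.ofReal_im, Finset.sum_const_zero, mul_zero, sub_zero]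
    rfl
  rw [hre]
  have htq : t ^ 2 ≤ M * q := by
    have h := sq_sum_le_card_mul_sum_sq (s := (Finset.univ : Finset Λ)) (f := fun x => ‖φ x‖ ^ 2)
    simp only [Finset.card_univ] at h
    calc t ^ 2 = (∑ x, ‖φ x‖ ^ 2) ^ 2 := by rw [ht]
      _ ≤ (Fintype.card Λ : ℝ) * ∑ x, (‖φ x‖ ^ 2) ^ 2 := by exact_mod_cast h
      _ = M * q := by rw [hM, hq]; congr 1; exact Finset.sum_congr rfl fun x _ => by ring
  have ht0 : 0 ≤ t := Finset.sum_nonneg fun x _ => sq_nonneg _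
  have hνre : -ν.re * t ≤ R * t := by
    have : -ν.re ≤ R := ((neg_le_abs _).trans (Complex.abs_re_le_norm ν)).trans hν
    exact mul_le_mul_of_nonneg_right this ht0
  have hφt : ‖φ‖ ^ 2 ≤ t := norm_sq_le_sum_norm_sq φ
  -- `-g q ≤ -(g/M) t²` and the parabola bound
  have hgq : -(g * q) ≤ -(g / M) * t ^ 2 := by
    have : g / M * t ^ 2 ≤ g * q := by
      rw [div_mul_eq_mul_div, div_le_iff₀ hMpos]
      nlinarith [htq, hg.le]
    linarith
  have hpar : -(g / M) * t ^ 2 + (R + 1) * t ≤ M * (R + 1) ^ 2 / (4 * g) := by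
    have hα : 0 < g / M := div_pos hg hMpos
    have h := mul_nonneg hα.le (sq_nonneg (t - (R + 1) * M / (2 * g)))
    have hexp : g / M * (t - (R + 1) * M / (2 * g)) ^ 2 =
        g / M * t ^ 2 - (R + 1) * t + M * (R + 1) ^ 2 / (4 * g) := by
      field_simp; ring
    linarith [h, hexp]
  nlinarith [hgq, hpar, hνre, hφt]

/-- The constant `C_μ = Σ_S |μ_S|`. [folklore] -/
def momentConst (A : Matrix Λ Λ ℂ) : ℝ := ∑ S : Finset Λ, ‖orientSign Λ * (rowUnitMatrix A.transpose S).det‖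

omit [LinearOrder Λ] in
/-- `C_μ ≥ 0`. [folklore] -/
theorem momentConst_nonneg' (A : Matrix Λ Λ ℂ) [LinearOrder Λ] : 0 ≤ momentConst A :=
  Finset.sum_nonneg fun _ _ => norm_nonneg _

/-- The dominating envelope `K_R (1+‖φ‖)^{2|Λ|+4} e^{-‖φ‖²}`. [folklore] -/
def envelope (A : Matrix Λ Λ ℂ) (g R : ℝ) (φ : Λ → ℂ) : ℝ :=
  momentConst A * (2 * Fintype.card Λ + 1) * (1 + 2 * g + R) ^ Fintype.card Λ *
    Real.exp (Fintype.card Λ * (R + 1) ^ 2 / (4 * g)) * ((1 + ‖φ‖) ^ (2 * Fintype.card Λ + 4) *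
      Real.exp (-(1 * ‖φ‖ ^ 2)))

/-- The envelope is integrable on `ℂ^Λ`. [folklore] -/
theorem integrable_envelope (A : Matrix Λ Λ ℂ) (g R : ℝ) : Integrable (envelope A g R) :=
  (Boson.integrable_one_add_norm_pow_mul_exp_neg one_pos _).const_mul _

omit [LinearOrder Λ] in
/-- `‖φ_b φ̄_a‖ ≤ (1+‖φ‖)²`. [folklore] -/
theorem norm_obs_le (a b : Λ) (φ : Λ → ℂ) : ‖φ b * conj (φ a)‖ ≤ (1 + ‖φ‖) ^ 2 := by
  rw [norm_mul, Complex.norm_conj]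
  have ha := norm_le_pi_norm φ a
  have hb := norm_le_pi_norm φ b
  nlinarith [norm_nonneg (φ a), norm_nonneg (φ b), norm_nonneg φ]

omit [LinearOrder Λ] in
/-- `‖Σ_x|φ_x|²‖ ≤ |Λ|(1+‖φ‖)²` (as a complex number). [folklore] -/
theorem norm_sumSqC_le (φ : Λ → ℂ) : ‖sumSqC φ‖ ≤ Fintype.card Λ * (1 + ‖φ‖) ^ 2 := by
  unfold sumSqC
  rw [← Complex.ofReal_sum, Complex.norm_real, Real.norm_eq_abs,
    abs_of_nonneg (Finset.sum_nonneg fun x _ => sq_nonneg _)]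
  refine (sum_sq_le_card_mul φ).trans ?_
  refine mul_le_mul_of_nonneg_left ?_ (Nat.cast_nonneg _)
  nlinarith [norm_nonneg φ]

variable [Nonempty Λ]

/-- **Domination of `topC` and `∂_ν topC`** by the envelope, for `‖ν‖ ≤ R` (`R ≥ 0`, `g > 0`,
`Re φAφ̄ ≥ 0`). [folklore] -/
theorem norm_topC_le_and (hA : ∀ φ, 0 ≤ (Boson.quadForm A φ).re) (hg : 0 < g) (hR : 0 ≤ R)
    (hν : ‖ν‖ ≤ R) (a b : Λ) (φ : Λ → ℂ) :
    ‖topC A g a b ν φ‖ ≤ envelope A g R φ ∧ ‖topDerivC A g a b ν φ‖ ≤ envelope A g R φ := by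
  set M : ℕ := Fintype.card Λ with hM
  set u : ℝ := 1 + ‖φ‖ with hu
  have hu1 : 1 ≤ u := by rw [hu]; linarith [norm_nonneg φ]
  have hu0 : 0 ≤ u := by linarith
  -- the factors
  have h_obs : ‖φ b‖ * ‖conj (φ a)‖ ≤ u ^ 2 := by rw [← norm_mul]; exact norm_obs_le a b φ
  have h_gw : ‖Boson.gaussWeight A φ‖ ≤ 1 := by
    rw [Boson.norm_gaussWeight]; exact Real.exp_le_one_iff.2 (by linarith [hA φ])
  have h_exp : ‖cexp (-∑ x, interactionScalarC g ν x φ)‖ ≤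
      Real.exp (M * (R + 1) ^ 2 / (4 * g)) * Real.exp (-(1 * ‖φ‖ ^ 2)) := by
    rw [Complex.norm_exp, ← Real.exp_add]
    refine Real.exp_le_exp.2 ?_
    have := re_neg_sum_interactionScalarC_le hg hν φ
    rw [← hM] at this; linarith
  have h_site : siteEnvelope g R φ ≤ (1 + 2 * g + R) ^ M * u ^ (2 * M) := by
    refine (siteEnvelope_le hg.le hR φ).trans (le_of_eq ?_)
    rw [mul_pow, ← pow_mul, hu, hM]
  have h_site0 : 0 ≤ siteEnvelope g R φ := Finset.prod_nonneg fun x _ => by positivity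
  have hCμ := momentConst_nonneg' A
  have h_P : ‖coeffPoly A g ν φ‖ ≤ momentConst A * ((1 + 2 * g + R) ^ M * u ^ (2 * M)) :=
    (norm_coeffPoly_le hg.le hR hν φ).trans (mul_le_mul_of_nonneg_left h_site hCμ)
  have h_P' : ‖coeffPolyDeriv A g ν φ‖ ≤ momentConst A * (M * ((1 + 2 * g + R) ^ M * u ^ (2 * M))) :=
    (norm_coeffPolyDeriv_le hg.le hR hν φ).trans
      (mul_le_mul_of_nonneg_left (mul_le_mul_of_nonneg_left h_site (Nat.cast_nonneg _)) hCμ)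
  have h_s : ‖sumSqC φ‖ ≤ M * u ^ 2 := norm_sumSqC_le φ
  -- common core bound
  set B : ℝ := (1 + 2 * g + R) ^ M * u ^ (2 * M) with hB
  have hB0 : 0 ≤ B := by positivity
  set E : ℝ := Real.exp (M * (R + 1) ^ 2 / (4 * g)) * Real.exp (-(1 * ‖φ‖ ^ 2)) with hE
  have hE0 : 0 ≤ E := by positivity
  have henv : envelope A g R φ = momentConst A * (2 * M + 1) * (1 + 2 * g + R) ^ M *
      Real.exp (M * (R + 1) ^ 2 / (4 * g)) * (u ^ (2 * M + 4) * Real.exp (-(1 * ‖φ‖ ^ 2))) := by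
    simp only [envelope, hM, hu]
  -- `u² · 1 · E · (Cμ B) ≤ env` and `u² · E · (M u² Cμ B + Cμ M B) ≤ env`
  have hcore : u ^ 2 * E * (momentConst A * ((2 * M + 1) * u ^ 2 * B)) = envelope A g R φ := by
    rw [henv, hB, hE]; ring
  have hpow : u ^ 2 * E * (momentConst A * B) ≤ envelope A g R φ := by
    rw [← hcore]
    refine mul_le_mul_of_nonneg_left (mul_le_mul_of_nonneg_left ?_ hCμ) (mul_nonneg (by positivity) hE0)
    have hM1 : (1 : ℝ) ≤ 2 * (M : ℝ) + 1 := by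
      have := (Nat.cast_nonneg M : (0 : ℝ) ≤ M); linarith
    have hu2 : (1 : ℝ) ≤ u ^ 2 := by nlinarith [hu1]
    have : (1 : ℝ) * 1 * B ≤ (2 * M + 1) * u ^ 2 * B := by
      refine mul_le_mul_of_nonneg_right ?_ hB0
      exact mul_le_mul hM1 hu2 zero_le_one (by positivity)
    linarith
  constructor
  · -- `topC`
    have htop : topC A g a b ν φ = φ b * conj (φ a) *
        (Boson.gaussWeight A φ * cexp (-∑ x, interactionScalarC g ν x φ)) * coeffPoly A g ν φ := rfl
    rw [htop]
    simp only [norm_mul]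
    calc ‖φ b‖ * ‖conj (φ a)‖ * (‖Boson.gaussWeight A φ‖ * ‖cexp (-∑ x, interactionScalarC g ν x φ)‖) *
          ‖coeffPoly A g ν φ‖
        ≤ u ^ 2 * (1 * E) * (momentConst A * B) := by
          refine mul_le_mul (mul_le_mul h_obs (mul_le_mul h_gw h_exp (norm_nonneg _) zero_le_one)
            (by positivity) (by positivity)) h_P (norm_nonneg _) (by positivity)
      _ = u ^ 2 * E * (momentConst A * B) := by ring
      _ ≤ envelope A g R φ := hpow
  · -- `topDerivC`
    unfold topDerivC
    simp only [norm_mul]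
    have hlast : ‖-sumSqC φ * coeffPoly A g ν φ + coeffPolyDeriv A g ν φ‖ ≤
        momentConst A * ((2 * M + 1) * u ^ 2 * B) := by
      refine (norm_add_le _ _).trans ?_
      rw [norm_mul, norm_neg]
      have h1 : ‖sumSqC φ‖ * ‖coeffPoly A g ν φ‖ ≤ M * u ^ 2 * (momentConst A * B) :=
        mul_le_mul h_s h_P (norm_nonneg _) (by positivity)
      have h2 : (M : ℝ) * B ≤ (M + 1) * u ^ 2 * B := by
        refine mul_le_mul_of_nonneg_right ?_ hB0
        nlinarith [hu1, (Nat.cast_nonneg M : (0 : ℝ) ≤ M)]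
      calc ‖sumSqC φ‖ * ‖coeffPoly A g ν φ‖ + ‖coeffPolyDeriv A g ν φ‖
          ≤ M * u ^ 2 * (momentConst A * B) + momentConst A * (M * B) := add_le_add h1 h_P'
        _ ≤ M * u ^ 2 * (momentConst A * B) + momentConst A * ((M + 1) * u ^ 2 * B) := by
            linarith [mul_le_mul_of_nonneg_left h2 hCμ]
        _ = momentConst A * ((2 * M + 1) * u ^ 2 * B) := by ring
    calc ‖φ b‖ * ‖conj (φ a)‖ * (‖Boson.gaussWeight A φ‖ * ‖cexp (-∑ x, interactionScalarC g ν x φ)‖) *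
          ‖-sumSqC φ * coeffPoly A g ν φ + coeffPolyDeriv A g ν φ‖
        ≤ u ^ 2 * (1 * E) * (momentConst A * ((2 * M + 1) * u ^ 2 * B)) := by
          refine mul_le_mul (mul_le_mul h_obs (mul_le_mul h_gw h_exp (norm_nonneg _) zero_le_one)
            (by positivity) (by positivity)) hlast (norm_nonneg _) (by positivity)
      _ = envelope A g R φ := by rw [← hcore]; ring

omit [Nonempty Λ] in
/-- `φ ↦ topC(ν, φ)` is continuous. [folklore] -/
theorem continuous_topC (A : Matrix Λ Λ ℂ) (g : ℝ) (a b : Λ) (ν : ℂ) :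
    Continuous fun φ : Λ → ℂ => topC A g a b ν φ := by
  unfold topC Boson.gaussWeight Boson.quadForm interactionScalarC interactionCoeffC
  fun_prop

omit [Nonempty Λ] in
/-- `φ ↦ ∂_ν topC(ν, φ)` is continuous. [folklore] -/
theorem continuous_topDerivC (A : Matrix Λ Λ ℂ) (g : ℝ) (a b : Λ) (ν : ℂ) :
    Continuous fun φ : Λ → ℂ => topDerivC A g a b ν φ := by
  unfold topDerivC Boson.gaussWeight Boson.quadForm interactionScalarC coeffPoly coeffPolyDeriv sumSqC
    interactionCoeffC
  fun_prop

/-- **Differentiation under the `φ`-integral**: `ν ↦ ∫ topC(ν,φ) dφ` is complex differentiable with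
derivative `∫ ∂_ν topC dφ` (`g > 0`, `Re φAφ̄ ≥ 0`). [folklore] -/
theorem hasDerivAt_integral_topC (hA : ∀ φ, 0 ≤ (Boson.quadForm A φ).re) (hg : 0 < g) (a b : Λ) (ν₀ : ℂ) :
    HasDerivAt (fun ν => ∫ φ, topC A g a b ν φ) (∫ φ, topDerivC A g a b ν₀ φ) ν₀ := by
  set R : ℝ := ‖ν₀‖ + 1 with hRdef
  have hR : 0 ≤ R := by positivity
  have hball : ∀ ν ∈ Metric.ball ν₀ 1, ‖ν‖ ≤ R := fun ν hν => by
    have := Metric.mem_ball.1 hν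
    calc ‖ν‖ = ‖ν₀ + (ν - ν₀)‖ := by ring_nf
      _ ≤ ‖ν₀‖ + ‖ν - ν₀‖ := norm_add_le _ _
      _ ≤ ‖ν₀‖ + 1 := by rw [← dist_eq_norm]; linarith
  have hν₀ : ‖ν₀‖ ≤ R := by rw [hRdef]; linarith
  refine (hasDerivAt_integral_of_dominated_loc_of_deriv_le (μ := volume) (x₀ := ν₀)
    (s := Metric.ball ν₀ 1) (F := fun ν φ => topC A g a b ν φ) (F' := fun ν φ => topDerivC A g a b ν φ)
    (bound := envelope A g R) (Metric.ball_mem_nhds ν₀ one_pos)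
    (Eventually.of_forall fun ν => (continuous_topC A g a b ν).aestronglyMeasurable) ?_
    (continuous_topDerivC A g a b ν₀).aestronglyMeasurable ?_ (integrable_envelope A g R) ?_).2
  · exact (integrable_envelope A g R).mono' (continuous_topC A g a b ν₀).aestronglyMeasurable
      (Eventually.of_forall fun φ => (norm_topC_le_and hA hg hR hν₀ a b φ).1)
  · exact Eventually.of_forall fun φ ν hν => (norm_topC_le_and hA hg hR (hball ν hν) a b φ).2
  · exact Eventually.of_forall fun φ ν _ => hasDerivAt_topC A g a b φ ν

/-- **The form side is an entire function of `ν`** (`g > 0`, `Re φAφ̄ ≥ 0`).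
[cite: BauerschmidtBrydgesSlade2015LogCorr, Proposition 3.1 (proof: "both sides are analytic in ν")] -/
theorem differentiable_formSideC (hA : ∀ φ, 0 ≤ (Boson.quadForm A φ).re) (hg : 0 < g) (a b : Λ) :
    Differentiable ℂ fun ν => formSideC A g ν a b := by
  have h : (fun ν => formSideC A g ν a b) = fun ν =>
      orientSign Λ * ((Real.pi : ℂ)⁻¹) ^ Fintype.card Λ * ∫ φ, topC A g a b ν φ :=
    funext fun ν => formSideC_eq_integral A g ν a b
  rw [h]
  exact (differentiable_const _).mul fun ν => (hasDerivAt_integral_topC hA hg a b ν).differentiableAt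

/-- The form side is analytic on `ℂ`. [folklore] -/
theorem analyticOnNhd_formSideC (hA : ∀ φ, 0 ≤ (Boson.quadForm A φ).re) (hg : 0 < g) (a b : Λ) :
    AnalyticOnNhd ℂ (fun ν => formSideC A g ν a b) univ :=
  (differentiable_formSideC hA hg a b).differentiableOn.analyticOnNhd isOpen_univ

end FormSideAnalytic

/-! ### Proposition 3.1 for all real `ν` -/

section AllNu

variable {d n : ℕ} [NeZero n] {g : ℝ}

/-- **`G_{N,ν}(0,b) = ∫ e^{-S_{-Δ}}e^{-Σ(gτ²+ντ)} φ̄_0φ_b` for ALL complex `ν`** (`g > 0`): both sides are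
entire in `ν` and agree for real `ν > 0` (`torusTwoPoint_eq_superIntegral`), hence everywhere by the
identity theorem. [cite: BauerschmidtBrydgesSlade2015LogCorr, Proposition 3.1 (ν ∈ ℂ by analyticity)] -/
theorem torusTwoPointC_eq_formSideC (hg : 0 < g) (b : TorusSite d n) (ν : ℂ) :
    torusTwoPointC d n g ν b = formSideC (negLaplacianC d n) g ν 0 b := by
  have hf := analyticOnNhd_torusTwoPointC hg b
  have hF := analyticOnNhd_formSideC (Λ := TorusSite d n) (A := negLaplacianC d n)
    re_quadForm_negLaplacianC_nonneg hg 0 b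
  have heq : ∀ t : ℝ, 0 < t → torusTwoPointC d n g t b = formSideC (negLaplacianC d n) g t 0 b := by
    intro t ht
    rw [← torusTwoPoint_toReal_eq_torusTwoPointC hg t b, formSideC_ofReal, torusTwoPoint_eq_superIntegral hg ht b]
  -- the positive reals accumulate at `1`
  have htend : Tendsto (fun k : ℕ => (((1 + 1 / ((k : ℝ) + 1) : ℝ)) : ℂ)) atTop (𝓝[≠] (1 : ℂ)) := by
    refine tendsto_nhdsWithin_iff.2 ⟨?_, Eventually.of_forall fun k => ?_⟩
    · have h1 : Tendsto (fun k : ℕ => (1 + 1 / ((k : ℝ) + 1) : ℝ)) atTop (𝓝 (1 + 0)) :=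
        tendsto_one_div_add_atTop_nhds_zero_nat.const_add 1
      rw [add_zero] at h1
      have h2 := (Complex.continuous_ofReal.tendsto 1).comp h1
      rwa [Complex.ofReal_one] at h2
    · simp only [mem_compl_iff, mem_singleton_iff]
      intro h
      have h' := congrArg Complex.re h
      simp only [Complex.ofReal_re, Complex.one_re] at h'
      have : 0 < 1 / ((k : ℝ) + 1) := by positivity
      linarith
  have hfreq : ∃ᶠ z in 𝓝[≠] (1 : ℂ), torusTwoPointC d n g z b = formSideC (negLaplacianC d n) g z 0 b :=
    htend.frequently (Frequently.of_forall fun k => heq _ (by positivity))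
  exact hf.eqOn_of_preconnected_of_frequently_eq hF isPreconnected_univ (mem_univ _) hfreq (mem_univ ν)

/-- **Proposition 3.1 of Bauerschmidt–Brydges–Slade 2015, for every real `ν`** (`g > 0`, any `d`, any
period `n ≥ 1`): `G_{N,ν}(0,b) = ∫ e^{-Σ_x(τ_{Δ,x} + gτ_x² + ντ_x)} φ̄_0 φ_b`, i.e.
`((torusTwoPoint d n g ν b).toReal : ℂ) = superIntegral (φ_bφ̄_0 · (e^{-S_{-Δ_Λ}} · e^{-Σ(gτ_x²+ντ_x)}))`
— the `ν > 0` identity of `WeaklySAWSupersymmetricRepresentation.lean` continued analytically in `ν`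
(both sides entire: the walk side by the Gaussian decay `S_b(T) ≤ e^{-gT²/|Λ|}`, the form side by the
quartic `e^{-gΣ|φ_x|⁴}`). [cite: BauerschmidtBrydgesSlade2015LogCorr, Proposition 3.1]
[cite: BrydgesImbrieSlade2009, Theorem 5.1] -/
theorem torusTwoPoint_eq_superIntegral_real (hg : 0 < g) (ν : ℝ) (b : TorusSite d n) :
    (((torusTwoPoint d n g ν b).toReal : ℝ) : ℂ) =
      superIntegral (ofFun (fun φ => φ b * conj (φ 0)) *
        (superGauss (negLaplacianC d n) * interactionForm g ν)) := by
  rw [torusTwoPoint_toReal_eq_torusTwoPointC hg ν b, torusTwoPointC_eq_formSideC hg b, formSideC_ofReal]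

end AllNu


end CTWSAW

end Literature.Barriers.CriticalPhenomena
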